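import Summits.Ventures.PercRepro.Night2FatBudgetFS
import Summits.Ventures.PercRepro.Night2FatBudgetResidues

/-!
# PercRepro — `(3, 0)` at `|G| = 12` through the fatBudget with the face-sum constraint; residues M (night-2, gen 23)

With `fatBudgetFS 5 3 6 3 12 (13/60) (1/60) = 9/40` (at most three fat thin closures; the flat budget gave `17/60`) and
the two-hyperplane count, the count sum at `(3, 0)`, `n = 12` is `1.0128 ≥ 1`: the cell closes whenever two fat thin
members miss different sets and the fat thin members have at most THREE closures
(`localShadowHall_three_zero_six_twelve_of_twoFat_b3FS`).  **`shadowHall_seven_five_of_residuesM`**: residues L with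
the clause at `(3, 0)`, `|G| = 12` raised to «at least 4 fat thin closures».
-/

namespace PercRepro.Shadow

open Finset PerFlat ThmH

/-- The count sum of the cell `(3, 0)` at `n = 12` with the two-hyperplane count and the fatBudget `9/40`:
`1.0128 ≥ 1`. -/
theorem countSum_three_zero_twelve_b3FS :
    1 ≤ countSum 12 6 3 (cPrimeDGP 5 3 6 0 2) (9 / 40 : ℚ) (cntTwo 6) := by
  rw [cPrimeDGP_three_zero_two]
  unfold countSum DGenP.cjG cntTwo
  rw [show Finset.Icc 1 (12 - 6) = {1, 2, 3, 4, 5, 6} by decide]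
  repeat rw [Finset.sum_insert (by decide)]
  rw [Finset.sum_singleton]
  norm_num [Nat.choose_eq_descFactorial_div_factorial, Nat.descFactorial, Nat.factorial]

variable {α : Type*} [DecidableEq α] {M : Matroid α} [M.Finite]

open scoped Classical in
/-- **The cell `(3, 0)` at `|G| = 12` with two fat thin members missing DIFFERENT sets and at most THREE fat thin
closures**: (LI_G) through the two-hyperplane count and the fatBudget `9/40` (face-sum constraint). -/
theorem localShadowHall_three_zero_six_twelve_of_twoFat_b3FS {G : Finset α} (hG : G ∈ flatsQ M (5 + 1))
    (hd : (gr M \ G).card = 3) (hk : kColoops M G = 0)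
    (hs : ∀ e ∈ gr M, ∀ f ∈ gr M, e ≠ f → rkN M {e, f} = 2) (hl : ∀ e ∈ gr M, M.Indep {e})
    (hn : G.card = 12) {B₀ B₁ : Finset α} (hB₀ : B₀ ∈ thinMembers M 5 G) (hB₁ : B₁ ∈ thinMembers M 5 G)
    (hfat₀ : (G \ clF M B₀).card ≤ 2) (hfat₁ : (G \ clF M B₁).card ≤ 2)
    (hne : G \ clF M B₀ ≠ G \ clF M B₁) (hcl : (fatClosures M 5 G 2).card ≤ 3) :
    LocalShadowHall M 5 G := by
  have hk' : kColoops M G + 6 = 5 + 1 := by omega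
  have hd' : (gr M \ G).card ≤ 5 := by omega
  have hm2 : ∀ B ∈ thinMembers M 5 G, 6 ≤ (B \ coloops M G).card → 2 ≤ (G \ clF M B).card :=
    fun B hB _ => two_le_card_sdiff_of_not_lay0 hG hd' (mem_thinMembers.1 hB).1 (mem_thinMembers.1 hB).2
  have hc2 : 0 ≤ cPrimeDGP 5 3 6 (kColoops M G) 2 := by
    rw [hk]; unfold cPrimeDGP capDG reqDGP phiQ; norm_num
  have hn' : G.card - kColoops M G = 12 := by omega
  have hKG : coloops M G ⊆ G := fun y hy => (mem_coloops.1 hy).1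
  have hnK : (G \ coloops M G).card = 12 := by
    rw [Finset.card_sdiff_of_subset hKG, ← kColoops_eq_card_coloops]; omega
  refine localShadowHall_excess_of_count (d := 3) (ρ := 6) (m₁ := 2) hG hd (by norm_num) hk' (by norm_num)
    hs hl hc2 hm2 (E := (9 / 40 : ℚ)) (by norm_num) ?_ (cnt := cntTwo 6) ?_ ?_ ?_
  · intro S _ T hT
    have hT' : T ∈ (S \ coloops M G).powersetCard 6 := by
      unfold coverBases at hT
      exact (Finset.mem_filter.1 hT).1
    have h := sum_faceLoss_budgetFS_union_le (k := 3) (a := (13 / 60 : ℚ)) (b := (1 / 60 : ℚ)) hG hd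
      (by norm_num) hk' hk (by norm_num) hs hl (by norm_num) (by rw [hnK]; norm_num)
      (by rw [hnK]; intro m h1 h2; exact chord3_three_zero_12 m h1 (by omega)) (by norm_num)
      (by rw [hnK, fatBudgetFS_three_zero_twelve_three]; norm_num) hcl hT'
    rw [hnK, fatBudgetFS_three_zero_twelve_three] at h
    exact h
  · intro s h1 h2
    rw [hn'] at h2
    exact cntTwo_six_pos s h1 (by omega)
  · intro S hSG
    exact card_coverBases_le_cntTwo hk' (by norm_num) (coloops_subset_clF_of_mem_thinMembers hG hd' hB₀)
      (eRk_clF_le_of_mem_thinMembers hB₀) (coloops_subset_clF_of_mem_thinMembers hG hd' hB₁)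
      (eRk_clF_le_of_mem_thinMembers hB₁) hfat₀ hfat₁ hne hSG
  · rw [hn', hk]
    exact countSum_three_zero_twelve_b3FS

section SevenFiveM

variable {α' : Type} [DecidableEq α']

/-- **THE `(7, 5)` SHADOW ROW FOR EVERY FINITE MATROID MODULO THE RESIDUES M**: the residues L with the clause at
`(3, 0)`, `|G| = 12` raised from «at least 2» to «at least 4 fat thin closures». -/
theorem shadowHall_seven_five_of_residuesM
    (h20 : ∀ (N : Matroid α') [N.Finite] (G : Finset α'), CellHyp N G →
      (gr N \ G).card = 2 → kColoops N G = 0 → FatMember N G 6 3 →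
      (FatBasis N G 6 2 ∨ FatMember N G 6 2) → LocalShadowHall N 5 G)
    (h21 : ∀ (N : Matroid α') [N.Finite] (G : Finset α'), CellHyp N G →
      (gr N \ G).card = 2 → kColoops N G = 1 → FatMember N G 5 4 →
      (FatBasis N G 5 3 ∨ FatMember N G 5 3) → LocalShadowHall N 5 G)
    (h30 : ∀ (N : Matroid α') [N.Finite] (G : Finset α'), CellHyp N G →
      (gr N \ G).card = 3 → kColoops N G = 0 → 10 ≤ G.card → G.card ≤ 12 → FatMember N G 6 2 →
      FatBasis N G 6 2 → (G.card = 10 ∨ G.card = 12 → NoThreeDisjointFat N G 2) →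
      (G.card = 11 → NoFourDisjointFat N G 2) →
      (G.card = 10 → 5 ≤ (fatClosures N 5 G 2).card) → (G.card = 11 → 3 ≤ (fatClosures N 5 G 2).card) →
      (G.card = 12 → 4 ≤ (fatClosures N 5 G 2).card) → LocalShadowHall N 5 G)
    (h31 : ∀ (N : Matroid α') [N.Finite] (G : Finset α'), CellHyp N G →
      (gr N \ G).card = 3 → kColoops N G = 1 → 11 ≤ G.card → G.card ≤ 17 → FatMember N G 5 2 →
      (G.card = 17 → FatBasis N G 5 2) → (G.card = 17 → NestedFat N G 2 3) →
      (G.card = 16 → MeetingFat N G 2) → (11 ≤ G.card ∧ G.card ≤ 17 → NoThreeDisjointFat N G 2) →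
      (G.card = 11 ∨ G.card = 15 ∨ G.card = 16 → FatBasis N G 5 3) →
      (12 ≤ G.card ∧ G.card ≤ 14 → FatBasis N G 5 4) → LocalShadowHall N 5 G)
    (h32 : ∀ (N : Matroid α') [N.Finite] (G : Finset α'), CellHyp N G →
      (gr N \ G).card = 3 → kColoops N G = 2 → FatMember N G 4 2 → LocalShadowHall N 5 G)
    (M : Matroid α') [M.Finite] : ShadowHall M 7 5 (phiK 7 5) := by
  apply shadowHall_seven_five_of_residuesL h20 h21 _ h31 h32
  intro N _ G hcell hd hk h10 h12 hfm hfb hnd3 hnd4 hc10 hc11 hc12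
  by_cases hfour : 4 ≤ (fatClosures N 5 G 2).card
  · exact h30 N G hcell hd hk h10 h12 hfm hfb hnd3 hnd4 hc10 hc11 (fun _ => hfour)
  · by_cases hG12 : G.card = 12
    · push Not at hfour
      obtain ⟨B₀, hB₀, B₁, hB₁, hf₀, hf₁, hne⟩ :=
        exists_twoFat_of_one_lt_card_fatClosures (M := N) (q := 5) (G := G) (by have := hc12 hG12; omega)
      exact localShadowHall_three_zero_six_twelve_of_twoFat_b3FS hcell.2.2.2 hd hk hcell.1 hcell.2.1 hG12
        hB₀ hB₁ hf₀ hf₁ hne (by omega)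
    · exact h30 N G hcell hd hk h10 h12 hfm hfb hnd3 hnd4 hc10 hc11 (fun h => absurd h hG12)

end SevenFiveM

end PercRepro.Shadow
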